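import Mathlib
import HarnessLib
import Summits.SmoothPoincare4.SmoothPoincare4.Theses.QuaternionicSimilarity
import Literature.Geometry.Riemannian.GreatSphereFibrationRadial
import Literature.Geometry.Riemannian.GreatSphereFibrationBaseSphere
import Literature.Geometry.Riemannian.GreatSphereFibrationsHahl

/-!
# Birth skeleton (BC3) — crux `QuaternionicSimilarity.GreatFibrationBaseStandard` (stmt-SmoothPoincare4-6272)

Route `route-SmoothPoincare4-QuaternionicSimilarity`, crux #3 `GreatFibrationBaseStandard` (BASE / N0): if
`p : S⁷ → M` is a `C^∞` surjective submersion of the unit sphere of `ℝ⁸` onto a Hausdorff second-countable smooth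
4-manifold all of whose fibres are great 3-spheres `S⁷ ∩ V` (`dim V = 4`), then `M ≅ S⁴`. In print this is
H. Hähl, Results Math. 12 (1987), Thm 1.3 / §4.8: Prop. 4.7 (the base `B(π)` is a twisted sphere `D⁴ ∪_φ D⁴`)
plus Cerf's `Γ₄ = 0`.

## READ FIRST — the crux AS TYPED is vacuous (known in the tree; the route needs a restatement)

The fibre clause of the route decl is `p ⁻¹' {p x} = {y | (y : EuclideanSpace ℝ (Fin 8)) ∈ V}` with an UNTYPED
binder `y`, so `(y : ℝ⁸)` is a type ascription, the right-hand side is `(V : Set ℝ⁸)` and the left-hand side is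
coerced to `Set ℝ⁸` (`Subtype.val '' (p ⁻¹' {p x})`): the hypothesis says that a set of UNIT vectors equals a
linear subspace (which contains `0`) and is never satisfied. Hence the crux as typed is TRIVIALLY TRUE — it is
verbatim the Literature def `Literature.Geometry.Riemannian.Hahl1987_greatSphereFibration_base_sphere`, proved
in the tree by `…_base_sphere_vacuous` (five lines, no mathematics); see the module note "Correction" of
`Literature/Geometry/Riemannian/GreatSphereFibrationsHahl.lean` and the registrar's probe
`bc/probe_vacuity.lean` (`example : GreatFibrationBaseStandard := Hahl1987_greatSphereFibration_base_sphere_vacuous`).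
The same clause makes `Straighten`, `Target` and `HopfGreatFibration` of this route FALSE as typed.
The INTENDED clause types the binder by the sphere: `p ⁻¹' {p x} = {y : S⁷ | ↑y ∈ V}` (tree structure
`Literature.Geometry.Riemannian.IsSmoothGreatSphereFibration p`, resp. `IsGreatSphereSubmersion 7 4 p`).

THIS SKELETON THEREFORE TARGETS THE INTENDED STATEMENT: the stubs are genuine lemmas of Hähl's proof for the
correctly typed hypothesis; `greatFibrationBaseStandard_corrected_of_pieces` proves the CORRECTED statement from
them (sorry-free composition through the tree's programme files), and the route decl follows from the corrected
statement by one honest line of logic (`Subtype.val` is injective, so the as-typed clause implies the typed one) —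
NOT through `False`. When the planner restates the crux (new item with the typed clause), only the last theorem of
this file changes; the stubs and the composition are exactly what the repaired crux needs.

## THE LINE = Hähl §4.8, cut at the frontier of the tree's proof programme

The tree already formalises Hähl §2 and 4.3–4.5 for the typed hypothesis (`Literature/Geometry/Riemannian/
GreatSphereFibration{Spread,Homogeneous,Charts,ChartInv,Transition,Radial}.lean`, all sorry-free): the spread of
fibre 4-planes `fibreSpan`, the two affine charts `baseChart` of the base (Hähl 2.9) as injective local
diffeomorphisms onto `M ∖ {pt}` with smooth left inverse `spreadCoord`, the transition map along rays `transG`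
(Hähl 4.3) and its radial monotonicity near `∞`, packaged as `GoodLevel Jinf J₀ t` with `exists_goodLevel` ("a level
`t > 0` small enough for the two-disc decomposition of the base at `Φ`-radius `t`"). The assembly "Prop 4.7 + Cerf ⇒
base `≅ S⁴`" is also proved (`Hahl1987_greatSphereFibration_base_sphere_of_isTwistedSphere_of_cerf`). What is NOT in
the tree is exactly:

* `stub_twistedSphere_of_goodLevel` (HÄHL PROP. 4.7 FROM A GOOD LEVEL — the load-bearing stub, size L): for a
  great-sphere submersion `p : S⁷ → M⁴` (the crux's hypotheses with the TYPED fibre clause, inline = the fields of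
  `IsGreatSphereSubmersion 7 4 p`), two points `x∞, e` in
  different fibres with frames `J∞ : ℝ⁴ ≃ V_{x∞}`, `J₀ : ℝ⁴ ≃ V_e`, and a good level `t`, the base `M` is a twisted
  sphere `D⁴ ∪_φ D⁴` for some self-diffeomorphism `φ` of `S³` (tree predicate
  `Literature.Topology.FourManifolds.IsTwistedSphere 3 φ M` = two smooth closed-ball embeddings covering `M` and
  meeting exactly along `φ`, cf. `BallGluingData`). Proof plan (Hähl 4.7, in the tree author's monotone form):
  inner disc `jA = Φ ∘ (t • ·)` on `𝔻⁴` (`Φ = baseChart p x∞ e J∞`, a diffeomorphism `ℝ⁴ ≅ M ∖ {∞}`); outer disc =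
  `{∞} ∪ {Φ c : ‖c‖ ≥ t}`, which in the chart `Ψ = baseChart p x∞ x∞ J₀` centred at `∞` is the compact star-shaped
  region `{r b : 0 ≤ r ≤ 1/ρ(b)}` where `ρ(b) ∈ (0, u₀)` is the unique parameter with `‖transG (b, ρ b)‖ = t`
  (strict monotonicity on the window + "≤ t ⇒ u < u₀"; `ρ` is smooth by the implicit function theorem since
  `∂ᵤ ‖transG‖² > 0`), hence the image of a smooth radial embedding `jB` of `𝔻⁴`; the seam map is
  `φ(b) = transG (b, ρ b) / t` up to the conventions of `IsTwistedSphere`. Why plausibly true: it is implied by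
  Prop. 4.7 itself (the conclusion does not depend on the auxiliary data), which is a published theorem.
* `stub_cerfGammaFour` (CERF 1968, `Γ₄ = 0`, size XL): every twisted 4-sphere is diffeomorphic to `S⁴` — verbatim
  the tree's NAMED FACT `Literature.Topology.FourManifolds.cerf_twistedSphere_four` (a `def … : Prop`, used in the
  tree as a hypothesis; stated here as a stub so that the skeleton names everything a sorry-free proof of BASE must
  supply; a prover may instead propose restating the repaired crux as conditional on this fact).
* `greatFibrationBaseStandard_corrected_of_pieces : stub₁-sig → stub₂-sig → (BASE, typed clause)` — THE REAL
  COMPOSITION, sorry-free: package the hypotheses as `IsGreatSphereSubmersion 7 4 p`; pick `x∞ ∈ S⁷`, a unit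
  vector `e ⊥ V_{x∞}` (`exists_mem_orthogonal_fibreSpan_norm_eq_one`), which lies in another fibre
  (`apply_greatSphereChartLift_ne`); frame the two fibre 4-planes (`finrank_fibreSpan`,
  `ContinuousLinearEquiv.ofFinrankEq`); take a good level (`exists_goodLevel`); stub 1 gives the twisted-sphere
  structure, stub 2 (Cerf) the diffeomorphism with `S⁴` (as in the tree's proved §4.8 assembly).
* `greatFibrationBaseStandard_of_pieces : stub₁-sig → stub₂-sig → (BASE as typed, unfolded)` — from the corrected
  statement by `Subtype.val_injective` (the as-typed clause implies the typed clause); conclusion written as the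
  crux's one-step unfolding so that `GreatFibrationBaseStandard_of` is the file's only theorem whose head is the
  crux name (`ledger skeleton check` shape).
* `GreatFibrationBaseStandard_of : GreatFibrationBaseStandard` — THE SKELETON THEOREM (crux BY NAME from the two
  declared stubs).

`sorry` occurs ONLY in the two `stub_*` theorems.

## Disproof used

None exists: `ledger crux ls stmt-SmoothPoincare4-6272` shows no `Disproof.lean`, no lines, no landed `Negative/`
lemma (2026-08-17). Item evidence honoured: literature-prover ANALYSIS(-v2) (Yang 1981 Thm 2/4 unusable; Hähl 1987
is the source — this line is Hähl's, not Yang's normal form), grounder g18-7 (crux = Hähl fact verbatim), idea-node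
g12 `VacuityCheck.lean` / `idea-affine-spread-charts.md` (vacuity + the affine-chart line; this skeleton is that
line cut at the tree's frontier). `ledger negatives --problem SmoothPoincare4` (2026-08-17): 0 refuted statements.

## BC3 probes

`bc/probe_stub1.lean`, `bc/probe_stub2.lean`: for each stub `X`, `X → GreatFibrationBaseStandard` and
`X → SmoothPoincare4` by `first | exact? | simpa | aesop` — results in the registrar's NOTES.md / evidence note.
CAVEAT recorded there: since the crux as typed is trivially true, `X → GreatFibrationBaseStandard` HOLDS for every
`X` (by `fun _ => …_vacuous`), whatever the syntactic probes say; the meaningful probes are against the corrected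
statement, which is not trivial (it is Hähl's theorem).

## References

* H. Hähl, *Differentiable fibrations of the (2n−1)-sphere by great (n−1)-spheres and their coordinatization over
  quasifields*, Results Math. 12 (1987) 99–118, doi:10.1007/bf03322382 — 2.1, 2.9, 4.3, 4.5, Prop. 4.7, §4.8,
  Thm 1.3. [Hahl1987]
* J. Cerf, *Sur les difféomorphismes de la sphère de dimension trois (Γ₄ = 0)*, LNM 53 (1968). [Cerf1968]
* H. Gluck, F. Warner, C. T. Yang, Duke Math. J. 50 (1983) 1041–1076. [GluckWarnerYang1983]
* T. Grundhöfer, H. Hähl, J. Differential Geom. 31 (1990) 357–363 (Yang's Thm 2/4 corrected). [GrundhoferHahl1990]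
-/

-- `Summit.<Summit>.<Problem>`: single-conjunct summit, the duplicate component is mandated (CONVENTIONS §2).
set_option linter.dupNamespace false
set_option linter.unusedVariables false

noncomputable section

namespace Summit.SmoothPoincare4.SmoothPoincare4.Cruxes.GreatFibrationBaseStandard.Birth

open scoped Manifold ContDiff Topology
open Set Function Module
open Summit.SmoothPoincare4.SmoothPoincare4.Theses.QuaternionicSimilarity

/-- `dim ℝ⁸ = 7 + 1` as a `Fact` instance: feeds the `[Fact (finrank ℝ E = d + 1)]` binder of the tree's generic
great-sphere-submersion API (`IsGreatSphereSubmersion 7 4 p`, `exists_goodLevel`, …) at `E = ℝ⁸`. Mathlib only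
registers the sphere's charts for `EuclideanSpace ℝ (Fin (n + 1))` directly (and a scoped `Fact (finrank = n)`);
any two such instances are definitionally equal (proof irrelevance), so consumers may re-declare it freely. -/
instance instFactFinrankEuclideanEight : Fact (Module.finrank ℝ (EuclideanSpace ℝ (Fin 8)) = 7 + 1) :=
  ⟨by simp⟩

/-! ## The two registered stubs -/

/-- **Stub 1 `stub_twistedSphere_of_goodLevel` — Hähl's Prop. 4.7 from a good level (the load-bearing stub).**
For a smooth great-3-sphere submersion `p : S⁷ → M⁴` (the crux's four hypotheses with the fibre binder TYPED by the
sphere — the field list of `Literature.Geometry.Riemannian.IsGreatSphereSubmersion 7 4 p`, written inline so that the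
signature needs no `Fact (finrank ℝ ℝ⁸ = 7 + 1)` instance), points `xinf`, `e` of `S⁷` in different fibres,
frames `Jinf : ℝ⁴ ≃L V_{xinf}`, `J₀ : ℝ⁴ ≃L V_e` of the two fibre 4-planes, and a good level `t`
(`Literature.Geometry.Riemannian.GoodLevel Jinf J₀ t`: the radial monotonicity of the chart transition near `∞`,
available from the tree's `exists_goodLevel`), the base `M` is a twisted 4-sphere: `IsTwistedSphere 3 φ M` for
some diffeomorphism `φ` of `S³` (two-disc decomposition at `Φ`-radius `t`: inner disc `Φ(t𝔻⁴)`, outer disc the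
star-shaped region `{‖Φ⁻¹ ∘ Ψ‖ ≥ t} ∪ {∞}` of the chart at `∞`, radial graph given by the implicit function
theorem). True because implied by Hähl's Prop. 4.7 (conclusion independent of the auxiliary data). Size L.
[Hahl1987, Prop. 4.7 and 4.3–4.5] -/
theorem stub_twistedSphere_of_goodLevel
    (M : Type) [TopologicalSpace M] [T2Space M] [SecondCountableTopology M]
    [ChartedSpace (EuclideanSpace ℝ (Fin 4)) M] [IsManifold (𝓡 4) ∞ M]
    (p : Metric.sphere (0 : EuclideanSpace ℝ (Fin 8)) 1 → M)
    (hp : ContMDiff (𝓡 7) (𝓡 4) ∞ p) (hsurj : Function.Surjective p)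
    (hsubm : ∀ x, Function.Surjective (mfderiv (𝓡 7) (𝓡 4) p x))
    (hfib : ∀ x, ∃ V : Submodule ℝ (EuclideanSpace ℝ (Fin 8)), Module.finrank ℝ V = 4 ∧
      p ⁻¹' {p x} = {y : Metric.sphere (0 : EuclideanSpace ℝ (Fin 8)) 1 | (y : EuclideanSpace ℝ (Fin 8)) ∈ V})
    (xinf e : Metric.sphere (0 : EuclideanSpace ℝ (Fin 8)) 1) (he : p e ≠ p xinf)
    (Jinf : EuclideanSpace ℝ (Fin 4) ≃L[ℝ] Literature.Geometry.Riemannian.fibreSpan p xinf)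
    (J₀ : EuclideanSpace ℝ (Fin 4) ≃L[ℝ] Literature.Geometry.Riemannian.fibreSpan p e)
    (t : ℝ) (ht : Literature.Geometry.Riemannian.GoodLevel Jinf J₀ t) :
    ∃ φ : (Metric.sphere (0 : EuclideanSpace ℝ (Fin 4)) 1) ≃ₘ⟮𝓡 3, 𝓡 3⟯
        (Metric.sphere (0 : EuclideanSpace ℝ (Fin 4)) 1),
      Literature.Topology.FourManifolds.IsTwistedSphere 3 φ M := by
  sorry

/-- **Stub 2 `stub_cerfGammaFour` — Cerf's theorem `Γ₄ = 0` in twisted-sphere form.** Every twisted 4-sphere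
`D⁴ ∪_φ D⁴` (`φ` any self-diffeomorphism of `S³`) is diffeomorphic to the standard `S⁴`: verbatim the tree's named
fact `Literature.Topology.FourManifolds.cerf_twistedSphere_four` (Cerf 1968; Kervaire–Milnor 1963 §1), the second
input of Hähl's §4.8 ("In view of 4.7, this is an immediate consequence of CERF's result"). Registered as a stub so
that the skeleton lists every obligation of a sorry-free proof of BASE; size XL (no formal proof of `Γ₄ = 0` exists).
[Cerf1968] [Hahl1987, §4.8] -/
theorem stub_cerfGammaFour : Literature.Topology.FourManifolds.cerf_twistedSphere_four := by
  sorry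

/-! ## Sorry-free composition -/

/-- Local notation: the unit 7-sphere of `ℝ⁸`. -/
local notation "𝕊⁷" => (Metric.sphere (0 : EuclideanSpace ℝ (Fin 8)) 1)

/-- **The corrected statement of BASE from the two stubs** (`stub₁-sig → stub₂-sig →` Hähl's §4.8 statement with
the fibre binder typed by the sphere), sorry-free: package the hypotheses as `IsGreatSphereSubmersion 7 4 p`
(`dim ℝ⁸ = 2·4`), choose `xinf ∈ S⁷` and a unit vector `e ⊥ V_{xinf}` (it exists since `dim V_{xinf}ᗮ = 4 > 0` and
lies in another fibre), frame the two fibre planes by `ContinuousLinearEquiv.ofFinrankEq`, take a good level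
(`exists_goodLevel`), apply stub 1 (twisted sphere) and stub 2 (Cerf) exactly as in the tree's proved §4.8
assembly `Hahl1987_greatSphereFibration_base_sphere_of_isTwistedSphere_of_cerf`. [Hahl1987, §4.8] -/
theorem greatFibrationBaseStandard_corrected_of_pieces
    (h47 : ∀ (M : Type) [TopologicalSpace M] [T2Space M] [SecondCountableTopology M]
      [ChartedSpace (EuclideanSpace ℝ (Fin 4)) M] [IsManifold (𝓡 4) ∞ M]
      (p : Metric.sphere (0 : EuclideanSpace ℝ (Fin 8)) 1 → M),
      ContMDiff (𝓡 7) (𝓡 4) ∞ p → Function.Surjective p →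
      (∀ x, Function.Surjective (mfderiv (𝓡 7) (𝓡 4) p x)) →
      (∀ x, ∃ V : Submodule ℝ (EuclideanSpace ℝ (Fin 8)), Module.finrank ℝ V = 4 ∧
        p ⁻¹' {p x} = {y : Metric.sphere (0 : EuclideanSpace ℝ (Fin 8)) 1 | (y : EuclideanSpace ℝ (Fin 8)) ∈ V}) →
      ∀ (xinf e : Metric.sphere (0 : EuclideanSpace ℝ (Fin 8)) 1), p e ≠ p xinf →
      ∀ (Jinf : EuclideanSpace ℝ (Fin 4) ≃L[ℝ] Literature.Geometry.Riemannian.fibreSpan p xinf)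
        (J₀ : EuclideanSpace ℝ (Fin 4) ≃L[ℝ] Literature.Geometry.Riemannian.fibreSpan p e)
        (t : ℝ), Literature.Geometry.Riemannian.GoodLevel Jinf J₀ t →
      ∃ φ : (Metric.sphere (0 : EuclideanSpace ℝ (Fin 4)) 1) ≃ₘ⟮𝓡 3, 𝓡 3⟯
          (Metric.sphere (0 : EuclideanSpace ℝ (Fin 4)) 1),
        Literature.Topology.FourManifolds.IsTwistedSphere 3 φ M)
    (hC : Literature.Topology.FourManifolds.cerf_twistedSphere_four)
    (M : Type) [TopologicalSpace M] [T2Space M] [SecondCountableTopology M]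
    [ChartedSpace (EuclideanSpace ℝ (Fin 4)) M] [IsManifold (𝓡 4) ∞ M]
    (p : 𝕊⁷ → M) (hp : ContMDiff (𝓡 7) (𝓡 4) ∞ p) (hsurj : Surjective p)
    (hsubm : ∀ x, Surjective (mfderiv (𝓡 7) (𝓡 4) p x))
    (hfib : ∀ x, ∃ V : Submodule ℝ (EuclideanSpace ℝ (Fin 8)), Module.finrank ℝ V = 4 ∧
      p ⁻¹' {p x} = {y : 𝕊⁷ | (y : EuclideanSpace ℝ (Fin 8)) ∈ V}) :
    Nonempty (M ≃ₘ⟮𝓡 4, 𝓡 4⟯ Metric.sphere (0 : EuclideanSpace ℝ (Fin 5)) 1) := by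
  have hE : Module.finrank ℝ (EuclideanSpace ℝ (Fin 8)) = 2 * 4 := by simp
  have hGS : Literature.Geometry.Riemannian.IsGreatSphereSubmersion 7 4 p := ⟨hE, hp, hsurj, hsubm, hfib⟩
  -- a base point `xinf` and a unit vector `e ⊥ V_{xinf}`; the point `e/‖e‖ = e` lies in a different fibre
  have hx : EuclideanSpace.single (0 : Fin 8) (1 : ℝ) ∈ Metric.sphere (0 : EuclideanSpace ℝ (Fin 8)) 1 := by
    simp
  obtain ⟨xinf⟩ : Nonempty 𝕊⁷ := ⟨⟨_, hx⟩⟩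
  obtain ⟨e, he, he1⟩ := Literature.Geometry.Riemannian.exists_mem_orthogonal_fibreSpan_norm_eq_one
    hfib hE (by norm_num) xinf
  obtain ⟨e', hne⟩ : ∃ e' : 𝕊⁷, p e' ≠ p xinf :=
    ⟨_, Literature.Geometry.Riemannian.apply_greatSphereChartLift_ne he he1 (Submodule.zero_mem _)⟩
  -- frames of the two fibre 4-planes
  have h4inf : Module.finrank ℝ (Literature.Geometry.Riemannian.fibreSpan p xinf) = 4 :=
    Literature.Geometry.Riemannian.finrank_fibreSpan hfib xinf
  have h4e : Module.finrank ℝ (Literature.Geometry.Riemannian.fibreSpan p e') = 4 :=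
    Literature.Geometry.Riemannian.finrank_fibreSpan hfib e'
  let Jinf : EuclideanSpace ℝ (Fin 4) ≃L[ℝ] Literature.Geometry.Riemannian.fibreSpan p xinf :=
    ContinuousLinearEquiv.ofFinrankEq (by rw [h4inf]; simp)
  let J₀ : EuclideanSpace ℝ (Fin 4) ≃L[ℝ] Literature.Geometry.Riemannian.fibreSpan p e' :=
    ContinuousLinearEquiv.ofFinrankEq (by rw [h4e]; simp)
  -- a good level exists (tree, Hähl 4.5/4.7), the base is a twisted sphere (stub 1), hence `≅ S⁴` (stub 2)
  obtain ⟨t, ht⟩ := Literature.Geometry.Riemannian.exists_goodLevel Jinf J₀ hGS hne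
  obtain ⟨φ, hφ⟩ := h47 M p hp hsurj hsubm hfib xinf e' hne Jinf J₀ t ht
  haveI : CompactSpace M := hφ.compactSpace
  exact hC φ { carrier := M, isTwistedSphere := hφ }

/-- **The route decl, unfolded, from the two stubs.** The conclusion is VERBATIM the body of
`QuaternionicSimilarity.GreatFibrationBaseStandard` (including its mis-typed fibre clause, which elaborates to
`Subtype.val '' (p ⁻¹' {p x}) = ↑V`); it follows from the corrected statement honestly: `Subtype.val` is injective,
so `Subtype.val '' (p ⁻¹' {p x}) = ↑V` implies `p ⁻¹' {p x} = {y : S⁷ | ↑y ∈ V}`. (The as-typed hypothesis is in fact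
never satisfied — the crux as typed is vacuous, see the module docstring — but this derivation does not use that.)
[Hahl1987, §4.8] -/
theorem greatFibrationBaseStandard_of_pieces
    (h47 : ∀ (M : Type) [TopologicalSpace M] [T2Space M] [SecondCountableTopology M]
      [ChartedSpace (EuclideanSpace ℝ (Fin 4)) M] [IsManifold (𝓡 4) ∞ M]
      (p : Metric.sphere (0 : EuclideanSpace ℝ (Fin 8)) 1 → M),
      ContMDiff (𝓡 7) (𝓡 4) ∞ p → Function.Surjective p →
      (∀ x, Function.Surjective (mfderiv (𝓡 7) (𝓡 4) p x)) →
      (∀ x, ∃ V : Submodule ℝ (EuclideanSpace ℝ (Fin 8)), Module.finrank ℝ V = 4 ∧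
        p ⁻¹' {p x} = {y : Metric.sphere (0 : EuclideanSpace ℝ (Fin 8)) 1 | (y : EuclideanSpace ℝ (Fin 8)) ∈ V}) →
      ∀ (xinf e : Metric.sphere (0 : EuclideanSpace ℝ (Fin 8)) 1), p e ≠ p xinf →
      ∀ (Jinf : EuclideanSpace ℝ (Fin 4) ≃L[ℝ] Literature.Geometry.Riemannian.fibreSpan p xinf)
        (J₀ : EuclideanSpace ℝ (Fin 4) ≃L[ℝ] Literature.Geometry.Riemannian.fibreSpan p e)
        (t : ℝ), Literature.Geometry.Riemannian.GoodLevel Jinf J₀ t →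
      ∃ φ : (Metric.sphere (0 : EuclideanSpace ℝ (Fin 4)) 1) ≃ₘ⟮𝓡 3, 𝓡 3⟯
          (Metric.sphere (0 : EuclideanSpace ℝ (Fin 4)) 1),
        Literature.Topology.FourManifolds.IsTwistedSphere 3 φ M)
    (hC : Literature.Topology.FourManifolds.cerf_twistedSphere_four) :
    ∀ (M : Type) [TopologicalSpace M] [T2Space M] [SecondCountableTopology M]
      [ChartedSpace (EuclideanSpace ℝ (Fin 4)) M] [IsManifold (𝓡 4) ∞ M]
      (p : Metric.sphere (0 : EuclideanSpace ℝ (Fin 8)) 1 → M),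
      ContMDiff (𝓡 7) (𝓡 4) ∞ p → Function.Surjective p →
      (∀ x, Function.Surjective (mfderiv (𝓡 7) (𝓡 4) p x)) →
      (∀ x, ∃ V : Submodule ℝ (EuclideanSpace ℝ (Fin 8)), Module.finrank ℝ V = 4 ∧
        p ⁻¹' {p x} = {y | (y : EuclideanSpace ℝ (Fin 8)) ∈ V}) →
      Nonempty (M ≃ₘ⟮𝓡 4, 𝓡 4⟯ Metric.sphere (0 : EuclideanSpace ℝ (Fin 5)) 1) := by
  intro M _ _ _ _ _ p hp hsurj hsubm hfib
  refine greatFibrationBaseStandard_corrected_of_pieces h47 hC M p hp hsurj hsubm fun x => ?_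
  obtain ⟨V, hV4, hV⟩ := hfib x
  refine ⟨V, hV4, Set.ext fun y => ⟨fun hy => ?_, fun hy => ?_⟩⟩
  · -- `y` in the fibre ⇒ `↑y ∈ Subtype.val '' fibre = ↑V`
    have hmem : (y : EuclideanSpace ℝ (Fin 8)) ∈
        {z : EuclideanSpace ℝ (Fin 8) | z ∈ V} := by
      rw [← hV]
      exact ⟨y, hy, rfl⟩
    exact hmem
  · -- `↑y ∈ V = Subtype.val '' fibre` ⇒ `y` in the fibre, by injectivity of `Subtype.val`
    have hmem : (y : EuclideanSpace ℝ (Fin 8)) ∈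
        {z : EuclideanSpace ℝ (Fin 8) | z ∈ V} := hy
    rw [← hV] at hmem
    obtain ⟨y', hy', hyy'⟩ := hmem
    have : y' = y := Subtype.ext hyy'
    subst this
    exact hy'

/-- **THE SKELETON THEOREM.** The crux `Summit.SmoothPoincare4.SmoothPoincare4.Theses.QuaternionicSimilarity.
GreatFibrationBaseStandard`, concluded BY NAME from the two DECLARED stubs `stub_twistedSphere_of_goodLevel`,
`stub_cerfGammaFour` (the only `sorry`s of the file) through the sorry-free compositions above. [Hahl1987, §4.8] -/
theorem GreatFibrationBaseStandard_of :
    Summit.SmoothPoincare4.SmoothPoincare4.Theses.QuaternionicSimilarity.GreatFibrationBaseStandard :=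
  greatFibrationBaseStandard_of_pieces stub_twistedSphere_of_goodLevel stub_cerfGammaFour

end Summit.SmoothPoincare4.SmoothPoincare4.Cruxes.GreatFibrationBaseStandard.Birth

end
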